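import Summits.QuantumFields.BalabanUV.Beta.D1BFx.PointColumnDual
import Summits.QuantumFields.BalabanUV.Beta.D1BFx.RProjectorRange

/-!
# `BalabanUV.Beta.D1BFx.PointColumnDecay` — road «BF-x» for binder row D1, sub-leaf **L2-gh** (part 2b of 3):
# THE FAR FIELD OF A POINT COLUMN OF THE B4-Sect.5 WHOLE-LATTICE KERNEL ON `ℤ^d` WITH THE MESH PREFACTOR:
# `|G′(x,q)| ≤ cFar(d,a)·k²·(n+1)^{−d}·e^{−4δ_u k}` and `|∇_x G′(x,q)| ≤ cFar(d,a)·k²·(n+1)^{−(d+1)}·e^{−4δ_u k}` whenever the blocks of `x` and `q`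
# are `≥ 8k` apart (`k ≥ 1`, `d ≥ 3`, `a > 0`)

HONEST FRAMING (cell contract, verbatim): «discharging `BetaPertH` makes Bałaban's UV stability UNCONDITIONAL — a real constructive-QFT
result; it is NOT the continuum limit and NOT the Clay problem.»  HONEST DEPENDENCY (verbatim): «continuum YM on T⁴ ⇐ BetaPertH ∧ nine
spine estimates (0/9 proved); BetaPertH ⇐ (D1) ∧ (D4) ∧ CAP+tail; G-an2-4 gates asym, D1 and NE2/3/4.»  THIS MODULE DISCHARGES NOTHING of
that: elementary elliptic regularity on `ℤ^d` (kernel-checked, [folklore]) for ONE leg species (T2's ghost leg) of ONE road to ONE conjunct (D1).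
0 wall binders instantiated; NOT A2′/A1.ii, NOT D1, NOT BetaPertH, NOT continuum, NOT Clay.
ABSOLUTE RULE (cell, verbatim): «No internally-minted statement may enter as a cited fact. Every hypothesis is either kernel-proved in this
package or a verbatim quotation of a PUBLISHED theorem with page reference.»  Nothing printed is asserted or cited; every theorem is proved
outright from pv23-g7's `B5Hk103ScalarZd` (`Gk`, `gq`, `sum_AX_mul_Gk`, `tsum_AX_mul`), pv23-g4's `PoissonInterior` (through
`BlockColumnSupNorm.interior_estimate_cI`), leaf-09-g2's `RProjectorRange.Gk_symm`, and my `BlockColumnSupNorm.abs_gq_le_sup`,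
`PointColumnSplit.tsum_AX_mul_eq`, `PointColumnDual.abs_sum_mul_Gk_le_dual`; one constant with a body (`cFar`), no `def … : Prop`.

WHY (rows d0/d1 of `SquareTable.oneLoopDrift_of_scalarBounds_avg` — `|Gf n b v| ≤ A₀e^{−(δ/n)|v|}/|v|²`, `|∇Gf| ≤ A₁e^{−(δ/n)|v|}/|v|³` with
`Gf = n²·Ggh` — for the ghost leg; A2′ `GhostRelegging`'s hypotheses).  Part 1 (`PointColumnSplit`) gives the near field `G′ = η²G₀ + O(η^d)`; here
the far field: the interior estimate AT THE FIELD POINT `x` on the cube of radius `3k(n+1)` (its blocks are `≤ 3k` from `blk x`, hence `≥ 5k` from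
`blk q`), fed with (A) `ΔG′(·,q) = aη^{d+2}·(G′Q′*)(q, blk ·)` off `q` (`lap_Gk_col`: `A·G′ = 1` + `Gk_symm`), bounded by `abs_gq_le_sup`, and (B) the
`ℓ¹` mass of the column on the cube from part 2a's DUAL REGULARITY against the sign pattern — the gain `1/√((n+1)^d)` there times `√vol/vol` here is
the full `η^d`: **`Gk_far_legs`** ⇒ **`abs_Gk_far_le`**, **`abs_Gk_diff_far_le`**.  At `d = 4`, `η^d·k²·e^{−4δ_u k}` at block separation `≍ k` is the
d0/d1 envelope `η²·e^{−δ′|v|η}/|v|²` (`d/2 = d − 2 = 2`); part 3 (`D1BFx/GhostLegFree`) packages the road rows.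
HONEST SCOPE: scalar `U = 1`, whole lattice, `d ≥ 3`; constants existential in `d`; exponents/polynomials not optimised; one forward difference
(`maxHeartbeats 400000` on the one long assembly, arithmetic only).
-/

namespace Summit.QuantumFields.BalabanUV.Beta.D1BFx.PointColumnDecay

open Finset Real
open Literature.MathematicalPhysics.QuantumFieldTheory.Balaban1983to89
open Literature.Probability.LatticeModels (latticeLaplacianZd)
open B4Sect5Exhaustion (limInv)
open B6QGQLower276 (X e blk B mem_B B_disjoint U mem_U sum_U sum_B_const side side_facts lapKer sameBlk AX AX_symm Aker)
open B6QGQDecay237 (cU deltaU cU_pos deltaU_pos deltaU_le_one gPrime_setDecay dist_blk_ge)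
open B5Hk103ScalarZd (Gk gq abs_Gk_le sum_AX_mul_Gk tsum_AX_mul tsum_Gk_mul_AX nbhd exp_rescale_le)
open Beta.PoissonInterior (cube mem_cube supNorm nrm)
open RProjectorRange (Gk_symm)
open BlockColumnPoisson (dist_blk_le_one dist_blk_le_one_of_mem_cube dist_le_one_of_mem_cube_one cube_subset_U card_cube)
open BlockColumnSupNorm (cI cI_nonneg interior_estimate_cI cG cG_pos abs_gq_le_sup)
open PointColumnSplit (tsum_AX_mul_eq)
open PointColumnDual (cDual cDual_pos abs_sum_mul_Gk_le_dual)

noncomputable section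

variable {d : ℕ}

/-! ## §2 The far field of a point column: `|G′(x,q)|, |∇G′(x,q)|` with the mesh prefactor `η^d`, `η^{d+1}` -/

/-- [folklore] **The Laplacian of a point column** `x ↦ G′(x,q)`: `Δ G′(·,q)(z) = −[z = q]/(n+1)² + a(n+1)^{−(d+2)}·(G′Q′*)(q, blk z)`
(`A·G′ = 1`, the block term read as a block column through `Gk_symm`). -/
theorem lap_Gk_col (n : ℕ) {a : ℝ} (ha : 0 < a) (q z : X d) :
    latticeLaplacianZd (fun x => Gk n a x q) z
      = -((if z = q then 1 else 0) / ((n : ℝ) + 1) ^ 2) + a / ((n : ℝ) + 1) ^ (d + 2) * gq n a q (blk n z) := by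
  classical
  have h : ∑' s : X d, AX n a z s * Gk n a s q = if z = q then 1 else 0 := by
    rw [tsum_AX_mul n a z, sum_AX_mul_Gk n ha z q]
  rw [tsum_AX_mul_eq] at h
  have hgq : ∑ s ∈ B n (blk n z), Gk n a s q = gq n a q (blk n z) := by
    rw [gq]; exact Finset.sum_congr rfl fun s _ => Gk_symm n ha s q
  rw [hgq] at h
  have hs : (0 : ℝ) < ((n : ℝ) + 1) ^ 2 := by positivity
  have h2 : latticeLaplacianZd (fun x => Gk n a x q) z
      = (a / ((n : ℝ) + 1) ^ d * gq n a q (blk n z) - (if z = q then 1 else 0)) / ((n : ℝ) + 1) ^ 2 := by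
    rw [eq_div_iff hs.ne']; linarith
  rw [h2, pow_add]
  field_simp
  ring

/-- [folklore] Integer division by `s > 0` at scale `j·s`: `|u − v| ≤ j·s ⇒ |u/s − v/s| ≤ j`. -/
theorem abs_ediv_sub_ediv_le {s u v : ℤ} (hs : 0 < s) {j : ℤ} (h : |u - v| ≤ j * s) : |u / s - v / s| ≤ j := by
  rw [abs_le] at h ⊢
  obtain ⟨h1, h2⟩ := h
  have hs0 : s ≠ 0 := hs.ne'
  constructor
  · have hle : v + (-j) * s ≤ u := by linarith
    have hm := Int.ediv_le_ediv hs hle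
    rw [Int.add_mul_ediv_right _ _ hs0] at hm
    linarith
  · have hle : u ≤ v + j * s := by linarith
    have hm := Int.ediv_le_ediv hs hle
    rw [Int.add_mul_ediv_right _ _ hs0] at hm
    linarith

/-- [folklore] A point of the cube of radius `j(n+1)` about `x` lies in a block within block distance `j` of `blk x`. -/
theorem dist_blk_le_of_mem_cube_mul {n j : ℕ} {x z : X d} (hz : z ∈ cube x (j * (n + 1))) :
    dist (blk n z) (blk n x) ≤ j := by
  refine (dist_pi_le_iff (by positivity)).2 fun i => ?_
  rw [Int.dist_eq]
  rw [mem_cube] at hz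
  have h := hz i
  have hi : |blk n z i - blk n x i| ≤ (j : ℤ) :=
    abs_ediv_sub_ediv_le (side_facts n).1 (by push_cast at h ⊢; simpa [side, mul_comm] using h)
  have : |((blk n z i : ℤ) : ℝ) - ((blk n x i : ℤ) : ℝ)| ≤ (j : ℝ) := by exact_mod_cast hi
  exact this

/-- [our object] **The far-field constant** `cFar(d,a) = cI d·(a·cG(d,a) + cDual(d,a)·7^d·e) + 1`. -/
def cFar (d : ℕ) (a : ℝ) : ℝ := cI d * (a * cG d a + cDual d a * 7 ^ d * Real.exp 1) + 1

/-- [folklore] `cFar d a > 0`. -/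
theorem cFar_pos (d : ℕ) {a : ℝ} (ha : 0 < a) : 0 < cFar d a := by
  unfold cFar; have := cI_nonneg d; have := cG_pos d ha; have := cDual_pos d ha; positivity

set_option maxHeartbeats 400000 in
/-- [folklore] **THE FAR FIELD OF A POINT COLUMN, both legs.**  If the blocks of `x` and `q` are at sup distance `≥ 8k` (`k ≥ 1`), then
`|G′(x,q)| ≤ cFar·k²·(n+1)^{−d}·e^{−4δ_u k}` and `|G′(x+e_μ,q) − G′(x,q)| ≤ cFar·k²·(n+1)^{−(d+1)}·e^{−4δ_u k}` — the interior estimate at `x` on the cube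
of radius `3k(n+1)` (blocks within `3k` of `blk x`, hence `≥ 5k > 4k` from `blk q`), with `|ΔG′(·,q)| ≤ a·cG·η^{d+2}e^{−4δ_u k}` there (`lap_Gk_col`,
`abs_gq_le_sup`) and the `ℓ¹` mass from DUAL REGULARITY (`abs_sum_mul_Gk_le_dual` against the sign pattern of the column on the cube). -/
theorem Gk_far_legs (hd : 3 ≤ d) (n : ℕ) {a : ℝ} (ha : 0 < a) (x q : X d) {k : ℕ} (hk : 1 ≤ k)
    (hxq : 8 * (k : ℝ) ≤ dist (blk n x) (blk n q)) :
    |Gk n a x q| ≤ cFar d a * (k : ℝ) ^ 2 / ((n : ℝ) + 1) ^ d * Real.exp (-(4 * deltaU d a * k)) ∧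
    ∀ μ : Fin d, |Gk n a (x + e μ) q - Gk n a x q|
      ≤ cFar d a * (k : ℝ) ^ 2 / ((n : ℝ) + 1) ^ (d + 1) * Real.exp (-(4 * deltaU d a * k)) := by
  classical
  set δ := deltaU d a with hδ
  have hδ0 : 0 < δ := deltaU_pos d ha
  have hs0 : (0 : ℝ) < (n : ℝ) + 1 := by positivity
  have hk0 : (0 : ℝ) < k := by exact_mod_cast hk
  have hk1 : (1 : ℝ) ≤ k := by exact_mod_cast hk
  set E := Real.exp (-(4 * δ * k)) with hE
  have hE0 : 0 < E := Real.exp_pos _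
  have hCI := cI_nonneg d
  have hcG := cG_pos d ha
  have hcD : 0 < cDual d a := cDual_pos d ha
  have he1 : (1 : ℝ) ≤ Real.exp 1 := Real.one_le_exp zero_le_one
  set u : X d → ℝ := fun z => Gk n a z q with hu
  set m : ℕ := k * (n + 1) with hm
  have hm1 : 1 ≤ m := by rw [hm]; exact Nat.one_le_iff_ne_zero.2 (Nat.mul_ne_zero (by omega) (by omega))
  have hmR : (m : ℝ) = k * ((n : ℝ) + 1) := by rw [hm]; push_cast; ring
  have hm0 : (0 : ℝ) < m := by rw [hmR]; positivity
  -- blocks of the cube of radius `3m = 3k(n+1)` about `x` are `≤ 3k` from `blk x`, hence `≥ 5k ≥ 4k + 1` from `blk q`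
  have hcube : ∀ z ∈ cube x (3 * m), (4 : ℝ) * k + 1 ≤ dist (blk n z) (blk n q) := by
    intro z hz
    have h3 : dist (blk n z) (blk n x) ≤ ((3 * k : ℕ) : ℝ) := by
      refine dist_blk_le_of_mem_cube_mul (n := n) (j := 3 * k) ?_
      rw [show 3 * k * (n + 1) = 3 * m by rw [hm]; ring]; exact hz
    push_cast at h3
    have := dist_triangle (blk n x) (blk n z) (blk n q)
    rw [dist_comm (blk n x) (blk n z)] at this
    linarith
  have hzq : ∀ z ∈ cube x (3 * m), z ≠ q := by
    intro z hz hzq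
    have := hcube z hz
    rw [hzq, dist_self] at this
    linarith
  -- (hA) the Laplacian on the cube
  set A : ℝ := a / ((n : ℝ) + 1) ^ (d + 2) * (cG d a * E) with hA
  have hAbd : ∀ z ∈ cube x (3 * m), |latticeLaplacianZd u z| ≤ A := by
    intro z hz
    have hl := lap_Gk_col n ha q z
    rw [if_neg (hzq z hz), zero_div, neg_zero, zero_add] at hl
    have hl' : latticeLaplacianZd u z = a / ((n : ℝ) + 1) ^ (d + 2) * gq n a q (blk n z) := by rw [hu]; exact hl
    rw [hl', abs_mul, abs_of_pos (by positivity), hA]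
    refine mul_le_mul_of_nonneg_left ((abs_gq_le_sup hd n ha q (blk n z)).trans ?_) (by positivity)
    refine mul_le_mul_of_nonneg_left ?_ hcG.le
    rw [hE, hδ, dist_comm]
    exact Real.exp_le_exp.2 (by nlinarith [hcube z hz, deltaU_pos d ha])
  -- (hB) the `ℓ¹` mass on the cube by dual regularity against the sign pattern
  set g : X d → ℝ := fun z => if 0 ≤ u z then 1 else -1 with hg
  have hg2 : ∑ z ∈ cube x (3 * m), g z ^ 2 = ((2 * (3 * m) + 1 : ℕ) : ℝ) ^ d := by
    have : ∀ z ∈ cube x (3 * m), g z ^ 2 = 1 := fun z _ => by simp only [hg]; split_ifs <;> norm_num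
    rw [Finset.sum_congr rfl this, Finset.sum_const, card_cube, nsmul_eq_mul, mul_one, Nat.cast_pow]
  have hdual := abs_sum_mul_Gk_le_dual hd n ha (cube x (3 * m)) g q (Rb := 4 * k - 1) (by linarith)
    (fun z hz => by linarith [hcube z hz])
  have hL : ∑ z ∈ cube x (3 * m), g z * Gk n a z q = ∑ z ∈ cube x (3 * m), |u z| := by
    refine Finset.sum_congr rfl fun z _ => ?_
    simp only [hg, hu]
    split_ifs with h
    · rw [one_mul, abs_of_nonneg h]
    · rw [abs_of_neg (not_le.mp h)]; ring
  rw [hL, hg2, abs_of_nonneg (Finset.sum_nonneg fun z _ => abs_nonneg _)] at hdual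
  -- `√((6m+1)^d) ≤ (7k)^d · √((n+1)^d)`: the block volume cancels against the dual-regularity gain
  set Sn := Real.sqrt (((n : ℝ) + 1) ^ d) with hSn
  have hSn0 : 0 < Sn := Real.sqrt_pos.2 (by positivity)
  have h7k1 : (1 : ℝ) ≤ (7 * (k : ℝ)) ^ d := one_le_pow₀ (by nlinarith)
  have hvol : Real.sqrt (((2 * (3 * m) + 1 : ℕ) : ℝ) ^ d) ≤ (7 * (k : ℝ)) ^ d * Sn := by
    have h7 : ((2 * (3 * m) + 1 : ℕ) : ℝ) ≤ 7 * k * ((n : ℝ) + 1) := by push_cast; rw [hmR]; nlinarith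
    have h7d : ((2 * (3 * m) + 1 : ℕ) : ℝ) ^ d ≤ (7 * (k : ℝ)) ^ d * ((n : ℝ) + 1) ^ d := by
      rw [← mul_pow]; exact pow_le_pow_left₀ (by positivity) h7 d
    calc Real.sqrt (((2 * (3 * m) + 1 : ℕ) : ℝ) ^ d) ≤ Real.sqrt ((7 * (k : ℝ)) ^ d * ((n : ℝ) + 1) ^ d) :=
          Real.sqrt_le_sqrt h7d
      _ = Real.sqrt ((7 * (k : ℝ)) ^ d) * Sn := by rw [Real.sqrt_mul (by positivity), hSn]
      _ ≤ (7 * (k : ℝ)) ^ d * Sn := by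
          refine mul_le_mul_of_nonneg_right ?_ hSn0.le
          rw [Real.sqrt_le_left (by positivity)]; nlinarith
  set Bc : ℝ := cDual d a * (Real.exp 1 * E) * (7 * (k : ℝ)) ^ d with hBc
  have hBbd : (∑ z ∈ cube x (3 * m), |u z|) ≤ Bc := by
    refine hdual.trans ?_
    have e1 : Real.exp (-(deltaU d a * (4 * k - 1))) ≤ Real.exp 1 * E := by
      rw [hE, hδ, ← Real.exp_add]
      exact Real.exp_le_exp.2 (by nlinarith [deltaU_pos d ha, deltaU_le_one d a])
    rw [div_le_iff₀ hSn0, hBc]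
    calc cDual d a * Real.exp (-(deltaU d a * (4 * k - 1))) * Real.sqrt (((2 * (3 * m) + 1 : ℕ) : ℝ) ^ d)
        ≤ cDual d a * (Real.exp 1 * E) * ((7 * (k : ℝ)) ^ d * Sn) :=
          mul_le_mul (mul_le_mul_of_nonneg_left e1 hcD.le) hvol (Real.sqrt_nonneg _) (by positivity)
      _ = cDual d a * (Real.exp 1 * E) * (7 * (k : ℝ)) ^ d * Sn := by ring
  obtain ⟨hval, hgrad⟩ := interior_estimate_cI hd hm1 u x A Bc hAbd hBbd
  -- arithmetic
  have hk2 : (1 : ℝ) ≤ (k : ℝ) ^ 2 := one_le_pow₀ hk1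
  set cD7 : ℝ := cDual d a * 7 ^ d * Real.exp 1 with hcD7
  have hcD70 : 0 < cD7 := by positivity
  have hkey : cI d * (a * cG d a + cD7) ≤ cFar d a := by unfold cFar; rw [hcD7]; linarith
  have hBval : Bc / (m : ℝ) ^ d = cD7 / ((n : ℝ) + 1) ^ d * E := by
    rw [hBc, hmR, mul_pow, mul_pow, hcD7]; field_simp
  have hBval' : Bc / (m : ℝ) ^ d ≤ cD7 * (k : ℝ) ^ 2 / ((n : ℝ) + 1) ^ d * E := by
    rw [hBval]
    have : cD7 / ((n : ℝ) + 1) ^ d * E = (cD7 / ((n : ℝ) + 1) ^ d * E) * 1 := (mul_one _).symm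
    rw [this]
    calc cD7 / ((n : ℝ) + 1) ^ d * E * 1 ≤ cD7 / ((n : ℝ) + 1) ^ d * E * (k : ℝ) ^ 2 :=
          mul_le_mul_of_nonneg_left hk2 (by positivity)
      _ = _ := by ring
  have hBgrad : Bc / (m : ℝ) ^ (d + 1) ≤ cD7 * (k : ℝ) ^ 2 / ((n : ℝ) + 1) ^ (d + 1) * E := by
    have e1 : Bc / (m : ℝ) ^ (d + 1) = cD7 / ((n : ℝ) + 1) ^ (d + 1) * E / k := by
      rw [hBc, hmR, mul_pow, mul_pow, pow_succ, pow_succ, hcD7]; field_simp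
    rw [e1, div_le_iff₀ hk0]
    have hk3 : (1 : ℝ) ≤ (k : ℝ) ^ 2 * k := by nlinarith
    calc cD7 / ((n : ℝ) + 1) ^ (d + 1) * E = (cD7 / ((n : ℝ) + 1) ^ (d + 1) * E) * 1 := (mul_one _).symm
      _ ≤ (cD7 / ((n : ℝ) + 1) ^ (d + 1) * E) * ((k : ℝ) ^ 2 * k) :=
          mul_le_mul_of_nonneg_left hk3 (by positivity)
      _ = _ := by ring
  constructor
  · -- value leg
    have h1 : (m : ℝ) ^ 2 * A = a * cG d a * (k : ℝ) ^ 2 / ((n : ℝ) + 1) ^ d * E := by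
      rw [hA, hmR, pow_add]; field_simp
    calc |Gk n a x q| = |u x| := rfl
      _ ≤ cI d * ((m : ℝ) ^ 2 * A + Bc / (m : ℝ) ^ d) := hval
      _ ≤ cI d * (a * cG d a * (k : ℝ) ^ 2 / ((n : ℝ) + 1) ^ d * E + cD7 * (k : ℝ) ^ 2 / ((n : ℝ) + 1) ^ d * E) := by
          rw [h1]; exact mul_le_mul_of_nonneg_left (add_le_add le_rfl hBval') hCI
      _ = cI d * (a * cG d a + cD7) * ((k : ℝ) ^ 2 / ((n : ℝ) + 1) ^ d * E) := by ring
      _ ≤ cFar d a * ((k : ℝ) ^ 2 / ((n : ℝ) + 1) ^ d * E) := mul_le_mul_of_nonneg_right hkey (by positivity)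
      _ = cFar d a * (k : ℝ) ^ 2 / ((n : ℝ) + 1) ^ d * E := by ring
  · -- gradient leg
    intro μ
    have h1 : (m : ℝ) * A = a * cG d a * (k : ℝ) / ((n : ℝ) + 1) ^ (d + 1) * E := by
      rw [hA, hmR, pow_add, pow_succ]; field_simp; ring
    have h1' : (m : ℝ) * A ≤ a * cG d a * (k : ℝ) ^ 2 / ((n : ℝ) + 1) ^ (d + 1) * E := by
      rw [h1]
      have hkk : (k : ℝ) ≤ (k : ℝ) ^ 2 := by rw [sq]; exact le_mul_of_one_le_right hk0.le hk1
      have hc : 0 ≤ a * cG d a / ((n : ℝ) + 1) ^ (d + 1) * E := by positivity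
      calc a * cG d a * (k : ℝ) / ((n : ℝ) + 1) ^ (d + 1) * E = (a * cG d a / ((n : ℝ) + 1) ^ (d + 1) * E) * k := by ring
        _ ≤ (a * cG d a / ((n : ℝ) + 1) ^ (d + 1) * E) * (k : ℝ) ^ 2 := mul_le_mul_of_nonneg_left hkk hc
        _ = _ := by ring
    calc |Gk n a (x + e μ) q - Gk n a x q| = |u (x + Pi.single μ 1) - u x| := rfl
      _ ≤ cI d * ((m : ℝ) * A + Bc / (m : ℝ) ^ (d + 1)) := hgrad μ
      _ ≤ cI d * (a * cG d a * (k : ℝ) ^ 2 / ((n : ℝ) + 1) ^ (d + 1) * E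
            + cD7 * (k : ℝ) ^ 2 / ((n : ℝ) + 1) ^ (d + 1) * E) :=
          mul_le_mul_of_nonneg_left (add_le_add h1' hBgrad) hCI
      _ = cI d * (a * cG d a + cD7) * ((k : ℝ) ^ 2 / ((n : ℝ) + 1) ^ (d + 1) * E) := by ring
      _ ≤ cFar d a * ((k : ℝ) ^ 2 / ((n : ℝ) + 1) ^ (d + 1) * E) := mul_le_mul_of_nonneg_right hkey (by positivity)
      _ = cFar d a * (k : ℝ) ^ 2 / ((n : ℝ) + 1) ^ (d + 1) * E := by ring

/-- [folklore] **FAR-FIELD VALUE**: `|Gk n a x q| ≤ cFar(d,a)·k²·(n+1)^{−d}·e^{−4δ_u k}` when `dist (blk x) (blk q) ≥ 8k`, `k ≥ 1`. -/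
theorem abs_Gk_far_le (hd : 3 ≤ d) (n : ℕ) {a : ℝ} (ha : 0 < a) (x q : X d) {k : ℕ} (hk : 1 ≤ k)
    (hxq : 8 * (k : ℝ) ≤ dist (blk n x) (blk n q)) :
    |Gk n a x q| ≤ cFar d a * (k : ℝ) ^ 2 / ((n : ℝ) + 1) ^ d * Real.exp (-(4 * deltaU d a * k)) :=
  (Gk_far_legs hd n ha x q hk hxq).1

/-- [folklore] **FAR-FIELD GRADIENT**: `|Gk n a (x+e_μ) q − Gk n a x q| ≤ cFar(d,a)·k²·(n+1)^{−(d+1)}·e^{−4δ_u k}` when `dist (blk x) (blk q) ≥ 8k`, `k ≥ 1`. -/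
theorem abs_Gk_diff_far_le (hd : 3 ≤ d) (n : ℕ) {a : ℝ} (ha : 0 < a) (x q : X d) {k : ℕ} (hk : 1 ≤ k)
    (hxq : 8 * (k : ℝ) ≤ dist (blk n x) (blk n q)) (μ : Fin d) :
    |Gk n a (x + e μ) q - Gk n a x q| ≤ cFar d a * (k : ℝ) ^ 2 / ((n : ℝ) + 1) ^ (d + 1) * Real.exp (-(4 * deltaU d a * k)) :=
  (Gk_far_legs hd n ha x q hk hxq).2 μ

end

end Summit.QuantumFields.BalabanUV.Beta.D1BFx.PointColumnDecay
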